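import Summits.BirchSwinnertonDyer.BirchSwinnertonDyer.Theorems.SmallImageMuTransferMuTransferX9KolyvaginCocycleValue
import Literature.NumberTheory.EllipticCurves.IwasawaTwistModPkTower
import HarnessLib

set_option autoImplicit false

-- the summit and its single problem are both named `BirchSwinnertonDyer` (registry layout D-0017)
set_option linter.dupNamespace false

/-!
# Crux `KatoDivisibilityX9` (stmt-BirchSwinnertonDyer-20547), line `graded_euler_loss`, stub
# `stub_reciprocityPkAX9` (hG34ᵍ), item (M2) of `hKolyRecPk`, file 1: THE KOLYVAGIN COCYCLE AT LEVEL `p^k`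
# WITH ITS KEY RELATION — x10's `KolyvaginTwist.exists_kolyvaginCocycle_value` ported from `twistModP` to
# the T6a carrier `κ.twistModPk ρ hM J` (`p^k • M = 0`), along an ARBITRARY equivariant projection
# `π : 𝒯_L^{(k)} → 𝒯_J^{(k)}` killing the norm cocycle `ψ'`

Seat `bsd-line-k6-p4` (prover-bsd-line-k6-p4-g5-0, wave-2 stub worker B).  THEOREMS ONLY (no definition, no named
fact, no `sorry`); generic (`κ` a `ℤ_p`-extension of `ℚ`, `ρ` any discrete `Γ_ℚ`-module killed by `p^k` with no
non-zero vector fixed by `Gal(ℚ̄/ℚ(μ_ℓ))`); `--supports stmt-BirchSwinnertonDyer-20547 --as helper`.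

WHY A GENERAL `π`.  In the mod-`p` model the Euler factor `P = (1 − g⁻¹)²` dies modulo `T^{2e}`, so x10 took `π` =
truncation `𝒯_L → 𝒯_J`.  At level `p^k` (`k ≥ 2`), `P ≡ unit·ω²` with `ω = ω_N = (1+T)^{p^N} − 1` NOT a monomial
times a unit; it dies under `x ↦ m(S)·x mod T^J`, `m = T^J/ω² (mod p^k)` (`J = 2p^N k`), the embedding of the
`ω²`-carrier `Λ/(p^k, ω²)` into `Λ/(p^k, T^J)` (MEMO-es §15 STEP 3).  The derivative construction is insensitive to
the choice: this file takes ANY continuous intertwining `π` with `π ∘ ψ' = 0`.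

* §1 level-`p^k` plumbing (ports of x10 / k6-g3 one-liners): `toTopRep_twistModPk_ρ_apply`,
  `twistModPk_apply_eq_self_of_mem_inertia` (`ρ(ℐ_𝔔) = 1`, `κ(ℐ_𝔔) = 1` for `𝔔 ∣ q ∤ p`),
  `twistModPk_eq_zero_of_forall_apply_eq` (`𝒯_J^{(k)}` has no `U`-fixed vector when `M` has none: induction on
  `J` along the equivariant truncation), `pow_sub_one_smul_eq_zero_of_dvd` (`(ℓ − 1)·𝒯 = 0` when `p^k ∣ ℓ − 1`),
  `eq_zero_of_two_nsmul_eq_zero_pk`, `sum_range_natCast_zsmul_eq_zero_pk` (`C(n,2)·𝒯 = 0` for `p` odd, `p^k ∣ n`).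
* §2 **`exists_kolyvaginCocyclePk_value`** — data: `p` odd, `q` (prime `ℓ`, `ρ` unramified at `q`, `q ∤ p`,
  `p^k ∣ ℓ − 1`), a tame cocycle `y'` on `N = Gal(ℚ̄/ℚ(μ_ℓ))` in `𝒯_L^{(k)}` unramified at every `𝔓 ∤ p`, a global
  cocycle `ψ'` with `cor_N [y'] = [ψ']`, and `π : 𝒯_L^{(k)} →ⁱL 𝒯_J^{(k)}` with `π ∘ ψ' = 0`.  Output (x10 p469014's
  clauses verbatim at level `p^k`): `σ ∈ ℐ_{𝔓₀}`, `τq ∈ I_{ℚ_q}` over it whose mod-`ℓ` cyclotomic character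
  generates, `σ` trivial on `𝒯_J^{(k)}`, the Kolyvagin cocycle `Φ` of `π ∘ y'` with `hx` (unramified at `w ≠ q`,
  `w ∤ p`, `ρ` unramified at `w`) and `loc_q [Φ] ∈ H¹_tr`, a local Frobenius `r` with `res r ∈ N`, and THE KEY
  RELATION `Φ(res τq) = −π a'`, `(res r)·a' − a' = −ψ'(res r)` for a level-`L` norm witness `a'`.

NOT HERE (honest): the production of `(y', ψ')` from `IsEulerSystemClass` (item (M1), files
`…KolyvaginReciprocityPk{TameNorm,Shapiro,TameClass,EulerFactor,ValueInput}`), the projection `π = m(S)·(· mod T^J)`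
and the DIVISION of the key relation by `ω` (item (M2) file 2), the local `q`-term identity (item (M3)).

References: K. Rubin, *Euler Systems* (2000) §4.4 (Def. 4.4.4, Lemma 4.4.2), Thm. 4.5.1; B. Perrin-Riou, Ann. Inst.
Fourier 48 (1998) §3.1.2, Prop. 3.1.6; B. Mazur, K. Rubin, Mem. AMS 799 (2004) §5.3, App. A [MazurRubin2004];
L. Washington, GTM 83, §13.1–13.2, Prop. 13.2 [Washington1997]; HOME/MEMO-es.md §15 STEP 3.
-/

noncomputable section

open CategoryTheory Function Finset
open scoped NumberField Pointwise ContRepresentation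
open Field IsDedekindDomain NumberField
open Literature.NumberTheory.GaloisRepresentations
open Literature.NumberTheory.GaloisRepresentations.IsNonarchimedeanLocalField
open Literature.NumberTheory.EllipticCurves
open Literature.NumberTheory.EllipticCurves.ZpExtension
open Rat.HeightOneSpectrum
open Summit.BirchSwinnertonDyer.Rank1Residual.GaloisImage
open Summit.BirchSwinnertonDyer.Rank1Residual.GaloisImage.CyclotomicLevel.Rat
open Summit.BirchSwinnertonDyer.BirchSwinnertonDyer.Rank1Residual
open Summit.BirchSwinnertonDyer.BirchSwinnertonDyer.Rank1Residual.KolyvaginTwist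

universe u

namespace Summit.BirchSwinnertonDyer.BirchSwinnertonDyer.Theorems.OneSidedTwistSqueezeX9KatoDivisibilityX9KolyvaginReciprocityPkCocycle

/-! ### §1 Level-`p^k` plumbing -/

section Generic

variable {K : Type u} [Field K] {p : ℕ} [Fact p.Prime] (κ : ZpExtension K p)
variable {M : Type u} [AddCommGroup M] [TopologicalSpace M] [DiscreteTopology M] {k : ℕ}
variable (ρ : DiscreteGaloisModule K M) (hM : ∀ m : M, p ^ k • m = 0)

/-- **`𝒯_J^{(k)}` has no non-zero vector fixed by `U`** when `M` has none: by induction on `J` along the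
equivariant truncation `𝒯_{J+1}^{(k)} → 𝒯_J^{(k)}`, a fixed `x` is supported in the top coordinate, `x = m·T^J`,
on which `g` acts by `ρ(g)` (`unipotentPow_single_top`), so `m` is fixed (level-`p^k` twin of x9's
`TwistFixed.twistModP_eq_zero_of_forall_apply_eq`). [cite: Washington1997, §13.1–§13.2] -/
theorem twistModPk_eq_zero_of_forall_apply_eq (U : Subgroup (absoluteGaloisGroup K))
    (hU : ∀ m : M, (∀ σ ∈ U, ρ σ m = m) → m = 0) :
    ∀ (J : ℕ) (x : Fin J → M), (∀ σ ∈ U, κ.twistModPk ρ hM J σ x = x) → x = 0 := by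
  intro J
  induction J with
  | zero => intro x _; exact funext fun i => Fin.elim0 i
  | succ J ih =>
    intro x hx
    -- the truncation `x mod T^J` is fixed, hence `0`
    have hy : (fun i : Fin J => x (Fin.castLE (Nat.le_succ J) i)) = 0 := by
      refine ih _ fun σ hσ => ?_
      have h : κ.twistModPkTruncate ρ hM (J + 1) (Nat.le_succ J) (κ.twistModPk ρ hM (J + 1) σ x) =
          κ.twistModPk ρ hM J σ (κ.twistModPkTruncate ρ hM (J + 1) (Nat.le_succ J) x) :=
        (κ.twistModPkTruncate ρ hM (J + 1) (Nat.le_succ J)).isIntertwining σ x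
      rw [hx σ hσ] at h
      exact h.symm
    have hlow : ∀ i : Fin (J + 1), (i : ℕ) < J → x i = 0 := fun i hi => congrFun hy ⟨i, hi⟩
    -- so `x` is supported in the top coordinate
    have hJ1 : 0 < J + 1 := Nat.succ_pos J
    set m : M := x ⟨J + 1 - 1, Nat.sub_lt hJ1 Nat.one_pos⟩ with hm
    have hxs : x = Pi.single (⟨J + 1 - 1, Nat.sub_lt hJ1 Nat.one_pos⟩ : Fin (J + 1)) m := by
      funext i
      by_cases hi : i = ⟨J + 1 - 1, Nat.sub_lt hJ1 Nat.one_pos⟩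
      · rw [hi, Pi.single_eq_same]
      · rw [Pi.single_eq_of_ne hi]
        refine hlow i ?_
        have h1 := i.isLt
        have h2 : (i : ℕ) ≠ J := fun h => hi (Fin.ext (by simp [h]))
        omega
    -- and its top coefficient is fixed on `M`
    have hfix : ∀ σ ∈ U, ρ σ m = m := by
      intro σ hσ
      have h := hx σ hσ
      rw [hxs, ZpExtension.twistModPk_apply] at h
      have hmap : (fun i => ρ σ ((Pi.single (⟨J + 1 - 1, Nat.sub_lt hJ1 Nat.one_pos⟩ : Fin (J + 1))
          m : Fin (J + 1) → M) i)) =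
          (Pi.single (⟨J + 1 - 1, Nat.sub_lt hJ1 Nat.one_pos⟩ : Fin (J + 1)) (ρ σ m) :
            Fin (J + 1) → M) := by
        funext i
        by_cases hi : i = ⟨J + 1 - 1, Nat.sub_lt hJ1 Nat.one_pos⟩
        · rw [hi, Pi.single_eq_same, Pi.single_eq_same]
        · rw [Pi.single_eq_of_ne hi, Pi.single_eq_of_ne hi, map_zero]
      rw [hmap, ZpExtension.unipotentPow_single_top hJ1] at h
      have := congrFun h ⟨J + 1 - 1, Nat.sub_lt hJ1 Nat.one_pos⟩
      rwa [Pi.single_eq_same, Pi.single_eq_same] at this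
    rw [hxs, hU m hfix, Pi.single_zero]

variable (J : ℕ)

include hM in
omit [Fact p.Prime] [TopologicalSpace M] [DiscreteTopology M] in
/-- `(ℓ − 1)·𝒯_J^{(k)} = 0` when `p^k ∣ ℓ − 1` (`q ≡ 1 (mod p^k)`, automatic at an `E[p^k]`-split prime) and
`p^k·M = 0`. [folklore] -/
theorem pow_sub_one_smul_eq_zero_of_dvd {ℓ : ℕ} (hpl : p ^ k ∣ ℓ - 1) (x : Fin J → M) : (ℓ - 1) • x = 0 := by
  obtain ⟨c, hc⟩ := hpl
  funext i
  rw [Pi.smul_apply, Pi.zero_apply, hc, mul_comm, mul_smul, hM, smul_zero]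

include hM in
omit [TopologicalSpace M] [DiscreteTopology M] in
/-- On a `p^k`-torsion module with `p` ODD, `2·w = 0` forces `w = 0` (`w = (p^k+1)w = ((p^k+1)/2)(2w)`).
[cite: Washington1997, §13.1–§13.2] -/
theorem eq_zero_of_two_nsmul_eq_zero_pk (hp2 : p ≠ 2) {w : Fin J → M} (h2 : (2 : ℕ) • w = 0) : w = 0 := by
  have hpw : p ^ k • w = 0 := by
    funext i; rw [Pi.smul_apply, Pi.zero_apply, hM]
  have hodd : 2 ∣ p ^ k + 1 := by
    rcases (Fact.out : p.Prime).eq_two_or_odd with h | h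
    · exact absurd h hp2
    · have : p ^ k % 2 = 1 := by rw [Nat.pow_mod, h]; simp
      omega
  obtain ⟨c, hc⟩ := hodd
  have : (p ^ k + 1) • w = w := by rw [add_smul, hpw, one_smul, zero_add]
  rw [← this, hc, mul_comm, mul_smul, h2, smul_zero]

include hM in
omit [TopologicalSpace M] [DiscreteTopology M] in
/-- **`(Σ_{i<n} i) • x = 0` on `𝒯_J^{(k)}`** for `p` odd and `p^k ∣ n` (Gauss: `2·Σ_{i<n} i = n(n−1)`, and `n` kills
`𝒯_J^{(k)}`): the memo's "`C(n,2) = n(n−1)/2 ≡ 0`" making `κ̃(Fr) = C(n,2)·t_q = 0`.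
[cite: PerrinRiou1998AIF, §3.1.2] -/
theorem sum_range_natCast_zsmul_eq_zero_pk (hp2 : p ≠ 2) {n : ℕ} (hn : p ^ k ∣ n) (x : Fin J → M) :
    (∑ i ∈ range n, (i : ℤ)) • x = 0 := by
  have hnx : n • x = 0 := by
    obtain ⟨c, rfl⟩ := hn
    funext i; rw [Pi.smul_apply, Pi.zero_apply, mul_comm, mul_smul, hM, smul_zero]
  have h1 : (∑ i ∈ range n, (i : ℤ)) • x = (∑ i ∈ range n, i) • x := by
    rw [← Nat.cast_sum, natCast_zsmul]
  rw [h1]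
  apply eq_zero_of_two_nsmul_eq_zero_pk hM J hp2
  rw [← mul_smul, mul_comm, Finset.sum_range_id_mul_two]
  have : (n - 1) • (n • x) = 0 := by rw [hnx, smul_zero]
  rwa [← mul_smul, Nat.mul_comm] at this

end Generic

section Rat

variable {p : ℕ} [Fact p.Prime] {M : Type} [AddCommGroup M] [TopologicalSpace M]
  [DiscreteTopology M] {k : ℕ} (κ : ZpExtension ℚ p) (ρ : DiscreteGaloisModule ℚ M)
  (hM : ∀ m : M, p ^ k • m = 0) (J : ℕ)

/-- Unfolding: the `TopRep` action of `𝒯_J^{(k)}` is `κ.twistModPk`. [cite: Washington1997, §13.1–§13.2] -/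
theorem toTopRep_twistModPk_ρ_apply (g : absoluteGaloisGroup ℚ) (x : Fin J → M) :
    (κ.twistModPk ρ hM J).toTopRep.ρ g x = κ.twistModPk ρ hM J g x := rfl

/-- **The inertia group at `𝔔 ∣ q`, `q ∤ p`, acts trivially on `𝒯_J^{(k)}`** when `ρ` is unramified at `q`:
`ρ(ℐ_𝔔) = 1` and `κ(ℐ_𝔔) = 1` (a `ℤ_p`-extension is unramified outside `p`), so the twist exponent is `0`.
[cite: Washington1997, Prop. 13.2] -/
theorem twistModPk_apply_eq_self_of_mem_inertia {q : HeightOneSpectrum (𝓞 ℚ)}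
    (hpq : (p : 𝓞 ℚ) ∉ q.asIdeal) (hunr : GaloisRep.IsUnramifiedAt q ρ)
    {𝔔 : Ideal (absIntegers (𝓞 ℚ) ℚ)} (h𝔔 : 𝔔 ∈ q.primesAbove)
    {g : absoluteGaloisGroup ℚ} (hg : g ∈ 𝔔.inertia (absoluteGaloisGroup ℚ)) (x : Fin J → M) :
    κ.twistModPk ρ hM J g x = x := by
  have hρ : ρ g = 1 := hunr 𝔔 h𝔔 g hg
  have hκ : κ g = 1 := ZpExtension.mem_kerSubgroup.mp
    (ZpExtension.inertia_le_kerSubgroup_holds ℚ p κ hpq h𝔔 hg)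
  rw [twistModPk_apply, LocalSplitPrime.twistExponent_eq_zero_of_apply_eq_one κ (J + k) hκ,
    unipotentPow_zero, Module.End.one_apply]
  funext i
  rw [hρ]
  rfl

/-- **`𝒯_J^{(k)}` has no non-zero vector fixed by `N = Gal(ℚ̄/ℚ(μ_ℓ))`** as soon as `M` has none, in the
`TopRep` form `h0` consumed by `KolyvaginTwist.exists_kolyvaginCocycle`. [cite: Rubin2000, Lemma 4.4.2] -/
theorem twistModPk_eq_zero_of_forall_rootsOfUnityFixer (ℓ : ℕ)
    (hfix : ∀ m : M, (∀ g ∈ rootsOfUnityFixer ℚ ℓ, ρ g m = m) → m = 0)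
    (v : (κ.twistModPk ρ hM J).toTopRep)
    (hv : ∀ u : rootsOfUnityFixer ℚ ℓ,
      (κ.twistModPk ρ hM J).toTopRep.ρ (u : absoluteGaloisGroup ℚ) v = v) : v = 0 :=
  twistModPk_eq_zero_of_forall_apply_eq κ ρ hM (rootsOfUnityFixer ℚ ℓ) hfix J v fun g hg => hv ⟨g, hg⟩

/-! ### §2 The Kolyvagin cocycle at level `p^k` with its key relation -/

/-- **THE KOLYVAGIN COCYCLE AT LEVEL `p^k`, WITH ITS VALUE** (MU-TRANSFER-PROOF §3 Lemma 2 + (3.1), MEMO-es §15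
STEP 3).  Data: `p` odd; `κ`, `ρ` over `ℚ` with `p^k·M = 0` and `M^{Gal(ℚ̄/ℚ(μ_ℓ))} = 0`; the Chebotarev place `q`
(prime `ℓ`, `ρ` unramified at `q`, `q ∤ p`, `p^k ∣ ℓ − 1`); levels `J`, `L` and a continuous intertwining
`π : 𝒯_L^{(k)} → 𝒯_J^{(k)}`; a tame cocycle `y'` on `N = Gal(ℚ̄/ℚ(μ_ℓ))` with values in `𝒯_L^{(k)}` UNRAMIFIED AT
EVERY PRIME `𝔓 ∤ p`; a global cocycle `ψ'` of `𝒯_L^{(k)}` with the CLASS-LEVEL norm relation `cor_N [y'] = [ψ']`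
killed by `π` pointwise.  Output: a tame generator `σ ∈ ℐ_{𝔓₀}`, a local inertia element `τq` over it WHOSE
mod-`ℓ` CYCLOTOMIC CHARACTER GENERATES, `σ` trivial on `𝒯_J^{(k)}`, the Kolyvagin cocycle `Φ` of `π ∘ y'` with
**`hx`** (unramified at `w ≠ q`, `w ∤ p`, `ρ` unramified at `w`) and **`loc_q [Φ] ∈ H¹_tr`**, a local Frobenius
**`r` with `res r ∈ N`**, and THE KEY RELATION **`Φ(res τq) = −π a'`, `(res r)·a' − a' = −ψ'(res r)`** for a
level-`L` norm witness `a'`.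
[cite: Rubin2000, Def. 4.4.4, Lemma 4.4.2 and Thm. 4.5.1] [cite: PerrinRiou1998AIF, §3.1.2 and Prop. 3.1.6]
[cite: MazurRubin2004, §5.3] -/
theorem exists_kolyvaginCocyclePk_value (hp2 : p ≠ 2) (q : HeightOneSpectrum (𝓞 ℚ))
    [NeZero ((primesEquiv q : Nat.Primes) : ℕ)] [Fact (((primesEquiv q : Nat.Primes) : ℕ)).Prime]
    [NeZero ((((primesEquiv q : Nat.Primes) : ℕ) : ℕ) : q.adicCompletion ℚ)]
    [hNn : (rootsOfUnityFixer ℚ ((primesEquiv q : Nat.Primes) : ℕ)).Normal]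
    [Fintype (absoluteGaloisGroup ℚ ⧸ rootsOfUnityFixer ℚ ((primesEquiv q : Nat.Primes) : ℕ))]
    (hfix : ∀ m : M,
      (∀ g ∈ rootsOfUnityFixer ℚ ((primesEquiv q : Nat.Primes) : ℕ), ρ g m = m) → m = 0)
    (hpq : (p : 𝓞 ℚ) ∉ q.asIdeal) (hunr : GaloisRep.IsUnramifiedAt q ρ)
    (hdvd : p ^ k ∣ ((primesEquiv q : Nat.Primes) : ℕ) - 1)
    {L : ℕ} (π : (κ.twistModPk ρ hM L).toContRepresentation →ⁱL (κ.twistModPk ρ hM J).toContRepresentation)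
    (y' : contOneCocycles (subgroupRep (κ.twistModPk ρ hM L).toTopRep
      (rootsOfUnityFixer ℚ ((primesEquiv q : Nat.Primes) : ℕ))))
    (hyI' : ∀ w : HeightOneSpectrum (𝓞 ℚ), (p : 𝓞 ℚ) ∉ w.asIdeal → ∀ 𝔓 ∈ w.primesAbove,
      resLe (κ.twistModPk ρ hM L).toTopRep
        (inf_le_left : rootsOfUnityFixer ℚ ((primesEquiv q : Nat.Primes) : ℕ) ⊓
          𝔓.inertia (absoluteGaloisGroup ℚ) ≤ _) 1 (oneCocycleClass _ y') = 0)
    (ψ' : contOneCocycles (κ.twistModPk ρ hM L).toTopRep)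
    (hnorm : cores (κ.twistModPk ρ hM L).toTopRep
        (rootsOfUnityFixer ℚ ((primesEquiv q : Nat.Primes) : ℕ))
        (isOpen_rootsOfUnityFixer ℚ _) (oneCocycleClass _ y') = oneCocycleClass _ ψ')
    (hψJ : ∀ g : absoluteGaloisGroup ℚ, π (ψ'.1 g) = 0) :
    ∃ σ ∈ (adicCompletionPrime ℚ q).inertia (absoluteGaloisGroup ℚ),
      ∃ τq ∈ absInertia (q.adicCompletion ℚ),
      absGaloisRestrict ℚ (q.adicCompletion ℚ) τq = σ ∧
      (∀ u : (ZMod ((primesEquiv q : Nat.Primes) : ℕ))ˣ,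
        u ∈ Subgroup.zpowers (modPCyclotomicCharacterZMod (q.adicCompletion ℚ)
          ((primesEquiv q : Nat.Primes) : ℕ) τq)) ∧
      (∀ x : Fin J → M, κ.twistModPk ρ hM J σ x = x) ∧
      ∃ Φ : contOneCocycles (κ.twistModPk ρ hM J).toTopRep,
        (∀ w : HeightOneSpectrum (𝓞 ℚ), w ≠ q → (p : 𝓞 ℚ) ∉ w.asIdeal →
          GaloisRep.IsUnramifiedAt w ρ →
          galoisCohomology.localization (κ.twistModPk ρ hM J) (Sum.inr w) 1 (oneCocycleClass _ Φ) ∈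
            DiscreteGaloisModule.unramifiedSubgroup (GaloisRep.toLocal w (κ.twistModPk ρ hM J)) 1) ∧
        galoisCohomology.localization (κ.twistModPk ρ hM J) (Sum.inr q) 1 (oneCocycleClass _ Φ) ∈
          DiscreteGaloisModule.transverseSubgroup (GaloisRep.toLocal q (κ.twistModPk ρ hM J))
            (CyclotomicField ((primesEquiv q : Nat.Primes) : ℕ) (q.adicCompletion ℚ)) ∧
        ∃ r : absoluteGaloisGroup (q.adicCompletion ℚ), IsAbsArithFrob r ∧
          absGaloisRestrict ℚ (q.adicCompletion ℚ) r ∈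
            rootsOfUnityFixer ℚ ((primesEquiv q : Nat.Primes) : ℕ) ∧
          ∃ a' : Fin L → M,
            Φ.1 (absGaloisRestrict ℚ (q.adicCompletion ℚ) τq) = -π a' ∧
            κ.twistModPk ρ hM L (absGaloisRestrict ℚ (q.adicCompletion ℚ) r) a' - a' =
              -ψ'.1 (absGaloisRestrict ℚ (q.adicCompletion ℚ) r) := by
  have h𝔓₀ := adicCompletionPrime_mem_primesAbove ℚ q
  -- the generator
  obtain ⟨σ, hσI, hσn, hcov, hinj⟩ := exists_generator_mem_inertia q h𝔓₀
  -- inertia of `𝔓₀` acts trivially, at both levels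
  have hIL : ∀ τ ∈ (adicCompletionPrime ℚ q).inertia (absoluteGaloisGroup ℚ), ∀ w : Fin L → M,
      (κ.twistModPk ρ hM L).toTopRep.ρ τ w = w := fun τ hτ w =>
    twistModPk_apply_eq_self_of_mem_inertia κ ρ hM L hpq hunr h𝔓₀ hτ w
  have hIJ : ∀ τ ∈ (adicCompletionPrime ℚ q).inertia (absoluteGaloisGroup ℚ), ∀ w : Fin J → M,
      (κ.twistModPk ρ hM J).toTopRep.ρ τ w = w := fun τ hτ w =>
    twistModPk_apply_eq_self_of_mem_inertia κ ρ hM J hpq hunr h𝔓₀ hτ w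
  have hσL : ∀ w : Fin L → M, (κ.twistModPk ρ hM L).toTopRep.ρ σ w = w := hIL σ hσI
  have hσJ : ∀ w : Fin J → M, (κ.twistModPk ρ hM J).toTopRep.ρ σ w = w := hIJ σ hσI
  -- `X_J^N = 0`, `(ℓ - 1) • X = 0` at both levels
  have h0 := twistModPk_eq_zero_of_forall_rootsOfUnityFixer κ ρ hM J _ hfix
  have hnXJ : ∀ w : Fin J → M, ((((primesEquiv q : Nat.Primes) : ℕ) - 1 : ℕ) : ℤ) • w = 0 :=
    fun w => by rw [natCast_zsmul]; exact pow_sub_one_smul_eq_zero_of_dvd hM J hdvd w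
  have hnXL : ∀ w : Fin L → M, ((((primesEquiv q : Nat.Primes) : ℕ) - 1 : ℕ) : ℤ) • w = 0 :=
    fun w => by rw [natCast_zsmul]; exact pow_sub_one_smul_eq_zero_of_dvd hM L hdvd w
  -- `y'` vanishes on `N ∩ ℐ_{𝔓₀}`
  have hy'τ := apply_eq_zero_of_resLe_inf_eq_zero _ _
    ((adicCompletionPrime ℚ q).inertia (absoluteGaloisGroup ℚ)) hIL y' (hyI' q hpq _ h𝔓₀)
  -- the level-`L` norm witness `a'` from the CLASS-LEVEL norm relation
  have h𝒩' : ∑ i ∈ range (((primesEquiv q : Nat.Primes) : ℕ) - 1),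
      conjMap (κ.twistModPk ρ hM L).toTopRep (rootsOfUnityFixer ℚ ((primesEquiv q : Nat.Primes) : ℕ))
        (σ ^ i) 1 (oneCocycleClass _ y') =
      resSubgroup (κ.twistModPk ρ hM L).toTopRep
        (rootsOfUnityFixer ℚ ((primesEquiv q : Nat.Primes) : ℕ)) 1 (oneCocycleClass _ ψ') := by
    rw [sum_conjMap_pow_eq_resSubgroup_cores _ _ (isOpen_rootsOfUnityFixer ℚ _) hcov hinj, hnorm]
  obtain ⟨a', ha'⟩ := exists_norm_witness_of_sum_conjMap_eq_resSubgroup _ _ σ _ y' ψ' h𝒩'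
  -- the projection `π : 𝒯_L → 𝒯_J` as a morphism of `TopRep`, the projected cocycle `y = π ∘ y'`
  let πT : (κ.twistModPk ρ hM L).toTopRep ⟶ (κ.twistModPk ρ hM J).toTopRep :=
    TopRep.ofHom ⟨π.toContinuousLinearMap, π.isIntertwining'⟩
  have hπ : ∀ x : Fin L → M, πT.hom x = π x := fun _ => rfl
  let y : contOneCocycles (subgroupRep (κ.twistModPk ρ hM J).toTopRep
      (rootsOfUnityFixer ℚ ((primesEquiv q : Nat.Primes) : ℕ))) :=
    contOneCocycles.pullback (ContinuousMonoidHom.id _)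
      (Y := subgroupRep (κ.twistModPk ρ hM J).toTopRep
        (rootsOfUnityFixer ℚ ((primesEquiv q : Nat.Primes) : ℕ)))
      (TopRep.ofHom ⟨πT.hom.toContinuousLinearMap, fun g =>
        πT.hom.isIntertwining' (g : absoluteGaloisGroup ℚ)⟩) y'
  have hy : ∀ u, y.1 u = πT.hom (y'.1 u) := fun _ => rfl
  -- the transported norm witness `a = π a'` (`π` kills `ψ'`): `𝒩y = ∂(π a')`
  have ha : ∀ u : rootsOfUnityFixer ℚ ((primesEquiv q : Nat.Primes) : ℕ),
      ∑ i ∈ range (((primesEquiv q : Nat.Primes) : ℕ) - 1),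
        (κ.twistModPk ρ hM J).toTopRep.ρ (σ ^ i) (y.1 (subgroupConj _ (σ ^ i) u)) =
      (κ.twistModPk ρ hM J).toTopRep.ρ (u : absoluteGaloisGroup ℚ) (πT.hom a') - πT.hom a' := by
    intro u
    have h := norm_witness_map _ _ πT σ _ y' (fun u => ψ'.1 u) a' ha' u
    have hψ : πT.hom (ψ'.1 u) = 0 := by rw [hπ]; exact hψJ _
    rw [hψ, zero_add] at h
    exact h
  -- `y` vanishes on `N ∩ ℐ_{𝔓₀}`, in particular at `σ^{ℓ-1}`
  have hyτ : ∀ τ : rootsOfUnityFixer ℚ ((primesEquiv q : Nat.Primes) : ℕ),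
      (τ : absoluteGaloisGroup ℚ) ∈ (adicCompletionPrime ℚ q).inertia (absoluteGaloisGroup ℚ) →
        y.1 τ = 0 := fun τ hτ => by
    rw [hy, hy'τ τ hτ, map_zero]
  have hyσn : y.1 ⟨σ ^ (((primesEquiv q : Nat.Primes) : ℕ) - 1), hσn⟩ = 0 :=
    hyτ ⟨_, hσn⟩ (Subgroup.pow_mem _ hσI _)
  have hgen : ∀ g : absoluteGaloisGroup ℚ, ∃ i : ℕ,
      (σ ^ i)⁻¹ * g ∈ rootsOfUnityFixer ℚ ((primesEquiv q : Nat.Primes) : ℕ) := fun g => by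
    obtain ⟨i, -, hi⟩ := hcov g; exact ⟨i, hi⟩
  -- the Kolyvagin cocycle of `y` (Lemma 2), value `Φ(σ) = −π a'`
  obtain ⟨Φ, hΦN, hΦσ, -, -⟩ := exists_kolyvaginCocycle _ _ (isOpen_rootsOfUnityFixer ℚ _)
    h0 hσJ hσn hgen hnXJ y hyσn (πT.hom a') ha
  -- a local inertia element `τq` over `σ`, a local Frobenius `r` restricting into `N`
  have hσ' : σ ∈ (absInertia (q.adicCompletion ℚ)).map
      (absGaloisRestrict ℚ (q.adicCompletion ℚ)).toMonoidHom := by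
    rw [← inertia_adicCompletionPrime_eq_map_absInertia]; exact hσI
  obtain ⟨τq, hτq, hτqσ⟩ := Subgroup.mem_map.mp hσ'
  obtain ⟨r, hr, hrN⟩ := exists_isAbsArithFrob_absGaloisRestrict_mem q _ hcov hτq hτqσ
  refine ⟨σ, hσI, τq, hτq, hτqσ,
    forall_mem_zpowers_modPCyclotomicCharacterZMod_of_cov q hcov hτqσ, hσJ, Φ,
    fun w hwq hwp hwunr => ?_, ?_, r, hr, hrN, a', ?_, ?_⟩
  · -- `hx`: unramified at `w ≠ q`, `w ∤ p`
    have hwN : ∀ 𝔓 ∈ w.primesAbove, 𝔓.inertia (absoluteGaloisGroup ℚ) ≤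
        rootsOfUnityFixer ℚ ((primesEquiv q : Nat.Primes) : ℕ) :=
      rootsOfUnityFixer_unramifiedAt_of_not_mem ℚ _ (natCast_primesEquiv_not_mem_of_ne hwq)
    have hXw : ∀ 𝔓 ∈ w.primesAbove, ∀ τ ∈ 𝔓.inertia (absoluteGaloisGroup ℚ),
        ∀ x : (κ.twistModPk ρ hM L).toTopRep, (κ.twistModPk ρ hM L).toTopRep.ρ τ x = x :=
      fun 𝔓 h𝔓 τ hτ x => twistModPk_apply_eq_self_of_mem_inertia κ ρ hM L hwp hwunr h𝔓 hτ x
    have hy'w := forall_primesAbove_apply_eq_zero_of_resLe_inf_eq_zero _ _ hwN hXw y' (hyI' w hwp)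
    have hyw : ∀ 𝔓 (h𝔓 : 𝔓 ∈ w.primesAbove) (τ : absoluteGaloisGroup ℚ)
        (hτ : τ ∈ 𝔓.inertia (absoluteGaloisGroup ℚ)), y.1 ⟨τ, hwN 𝔓 h𝔓 hτ⟩ = 0 :=
      fun 𝔓 h𝔓 τ hτ => by rw [hy, hy'w 𝔓 h𝔓 τ hτ, map_zero]
    exact localization_mem_unramifiedSubgroup_of_forall_inertia_apply_eq_zero (κ.twistModPk ρ hM J)
      w Φ fun τ hτ => derivCocycle_apply_eq_zero_of_forall_primesAbove _ _ hwN σ _ y hyw Φ hΦN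
        (adicCompletionPrime_mem_primesAbove ℚ w) hτ
  · -- transverse at `q`: `Φ` vanishes at the `ℐ_{𝔓₀}`-normalising elements of `N`
    refine localization_mem_transverseSubgroup_of_forall_apply_eq_zero (κ.twistModPk ρ hM J) q _ Φ
      fun φ hφN hφ => ?_
    have hkill : ∀ i : ℕ,
        y.1 ((⟨φ, hφN⟩ : rootsOfUnityFixer ℚ ((primesEquiv q : Nat.Primes) : ℕ))⁻¹ *
          subgroupConj _ (σ ^ i) ⟨φ, hφN⟩) = 0 := fun i =>
      hyτ _ (inv_mul_conj_mem_of_normalises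
        ((adicCompletionPrime ℚ q).inertia (absoluteGaloisGroup ℚ)) hφ hσI i)
    rw [derivCocycle_apply_eq_sum_smul _ _ hσJ _ y Φ hΦN ⟨φ, hφN⟩ hkill]
    exact sum_range_natCast_zsmul_eq_zero_pk hM J hp2 hdvd _
  · -- the value at `res τq = σ`: `Φ(σ) = −π a'`
    change Φ.1 ((absGaloisRestrict ℚ (q.adicCompletion ℚ)).toMonoidHom τq) = _
    rw [hτqσ, hΦσ, hπ]
  · -- the key relation (3.1) at the Frobenius `φ = res r ∈ N`
    have hkill : ∀ i : ℕ,
        y'.1 ((⟨_, hrN⟩ : rootsOfUnityFixer ℚ ((primesEquiv q : Nat.Primes) : ℕ))⁻¹ *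
          subgroupConj _ (σ ^ i) ⟨_, hrN⟩) = 0 := fun i =>
      hy'τ _ (inv_mul_conj_mem_of_normalises
        ((adicCompletionPrime ℚ q).inertia (absoluteGaloisGroup ℚ))
        (fun τ hτ => absGaloisRestrict_normalises_inertia_adicCompletionPrime q r hτ) hσI i)
    have h := rho_sub_eq_of_norm_witness _ _ hσL _ y' (fun u => ψ'.1 u) a' ha' ⟨_, hrN⟩ hkill
    have hn0 : (((primesEquiv q : Nat.Primes) : ℕ) - 1) •
        y'.1 ⟨absGaloisRestrict ℚ (q.adicCompletion ℚ) r, hrN⟩ = 0 := by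
      have := hnXL (y'.1 ⟨absGaloisRestrict ℚ (q.adicCompletion ℚ) r, hrN⟩)
      rwa [natCast_zsmul] at this
    rw [hn0, zero_sub, toTopRep_twistModPk_ρ_apply] at h
    exact h

end Rat

end Summit.BirchSwinnertonDyer.BirchSwinnertonDyer.Theorems.OneSidedTwistSqueezeX9KatoDivisibilityX9KolyvaginReciprocityPkCocycle

end
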